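import Mathlib
import HarnessLib

/-!
# Route `ChiralWindow`, crux `CwThesis` (stmt-HubbardSuperconductivity-10438), line `SketchIdeator3`:
# vanishing of `L¹` mass near the diagonal of `cos 4θ`

On the torus `(-π, π] × (-π, π]` with the product of the restricted Lebesgue measures, for every
integrable `F` the integrals of `|F|` over the shrinking neighbourhoods
`{(θ, θ') | |cos 4θ - cos 4θ'| < 1/(n+1)}` of the level-set "diagonal" `{cos 4θ = cos 4θ'}` tend to `0`.
Mechanism (folklore): the neighbourhoods are antitone in `n`, so by monotone/dominated convergence
(`MeasureTheory.tendsto_setIntegral_of_antitone`) the integrals converge to the integral over their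
intersection, which is the level set `{cos 4θ = cos 4θ'}`; each of its sections `{θ' | cos 4θ' = cos 4θ}`
is countable (`Real.cos_eq_cos_iff`), hence Lebesgue-null, so the level set is null for the product
measure (`MeasureTheory.Measure.measure_prod_null_of_ae_null`) and the limit integral vanishes.
No definition is introduced.
-/

noncomputable section

namespace Summit.HubbardSuperconductivity.HubbardSuperconductivity.Theorems.CwThesis

-- the tree's namespace repeats the summit name by design (D-0017)
set_option linter.dupNamespace false

open MeasureTheory Real Set Filter

/-- Each section of the level set `{cos 4x = cos 4y}` is countable: by `Real.cos_eq_cos_iff` it lies in the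
range of `(k, b) ↦ (2kπ ± 4x)/4`, `k : ℤ`, `b : Bool`. [folklore] -/
theorem countable_setOf_cos_four_mul_eq (x : ℝ) :
    ({y : ℝ | Real.cos (4 * x) = Real.cos (4 * y)} : Set ℝ).Countable := by
  have hsub : {y : ℝ | Real.cos (4 * x) = Real.cos (4 * y)} ⊆
      Set.range (fun p : ℤ × Bool =>
        if p.2 then (2 * (p.1 : ℝ) * π + 4 * x) / 4 else (2 * (p.1 : ℝ) * π - 4 * x) / 4) := by
    intro y hy
    obtain ⟨k, hk⟩ := Real.cos_eq_cos_iff.1 hy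
    rcases hk with hk | hk
    · exact ⟨(k, true), by simp only [if_true]; linarith⟩
    · exact ⟨(k, false), by simp only [Bool.false_eq_true, if_false]; linarith⟩
  exact (Set.countable_range _).mono hsub

/-- The level set `{(θ, θ') | cos 4θ = cos 4θ'}` is null for the product of the restricted Lebesgue
measures on `(-π, π]`: all its sections are countable. [folklore] -/
theorem measure_setOf_cos_four_mul_eq_null :
    ((volume.restrict (Set.Ioc (-π) π)).prod (volume.restrict (Set.Ioc (-π) π)))
      {z : ℝ × ℝ | Real.cos (4 * z.1) = Real.cos (4 * z.2)} = 0 := by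
  refine Measure.measure_prod_null_of_ae_null (measurableSet_eq_fun (by fun_prop) (by fun_prop)) ?_
  refine Filter.Eventually.of_forall (fun x => ?_)
  simp only [Set.preimage_setOf_eq, Pi.zero_apply]
  exact (countable_setOf_cos_four_mul_eq x).measure_zero _

/-- **Vanishing of `L¹` mass near the `cos 4θ` diagonal.** For `F` integrable on the torus
`(-π, π] × (-π, π]` (product of restricted Lebesgue measures), the integral of `|F|` over
`{|cos 4θ - cos 4θ'| < 1/(n+1)}` tends to `0` as `n → ∞`. [folklore] -/
theorem stub_vanishingNearDiagonal {F : ℝ × ℝ → ℝ}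
    (hF : Integrable F ((volume.restrict (Set.Ioc (-π) π)).prod (volume.restrict (Set.Ioc (-π) π)))) :
    Filter.Tendsto (fun n : ℕ => ∫ z in {z : ℝ × ℝ | |Real.cos (4 * z.1) - Real.cos (4 * z.2)| < 1 / ((n : ℝ) + 1)},
        |F z| ∂((volume.restrict (Set.Ioc (-π) π)).prod (volume.restrict (Set.Ioc (-π) π))))
      Filter.atTop (nhds 0) := by
  set ν : Measure (ℝ × ℝ) :=
    (volume.restrict (Set.Ioc (-π) π)).prod (volume.restrict (Set.Ioc (-π) π)) with hν
  set S : ℕ → Set (ℝ × ℝ) := fun n =>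
    {z : ℝ × ℝ | |Real.cos (4 * z.1) - Real.cos (4 * z.2)| < 1 / ((n : ℝ) + 1)} with hS
  have hsm : ∀ n, MeasurableSet (S n) := fun n =>
    measurableSet_lt (by fun_prop) (by fun_prop)
  have h_anti : Antitone S := by
    intro m n hmn z hz
    simp only [hS, Set.mem_setOf_eq] at hz ⊢
    refine lt_of_lt_of_le hz ?_
    gcongr
  have hfi : ∃ n, IntegrableOn (fun z => |F z|) (S n) ν := ⟨0, hF.abs.integrableOn⟩
  have hlim := tendsto_setIntegral_of_antitone hsm h_anti hfi
  have hnull : ν (⋂ n, S n) = 0 := by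
    refine measure_mono_null ?_ measure_setOf_cos_four_mul_eq_null
    intro z hz
    simp only [Set.mem_iInter, hS, Set.mem_setOf_eq] at hz
    simp only [Set.mem_setOf_eq]
    by_contra hne
    have hpos : 0 < |Real.cos (4 * z.1) - Real.cos (4 * z.2)| := abs_pos.2 (sub_ne_zero.2 hne)
    obtain ⟨n, hn⟩ := exists_nat_one_div_lt hpos
    exact lt_irrefl _ ((hz n).trans hn)
  rwa [setIntegral_measure_zero _ hnull] at hlim

end Summit.HubbardSuperconductivity.HubbardSuperconductivity.Theorems.CwThesis

end
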